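import Summits.BirchSwinnertonDyer.BirchSwinnertonDyer.Theorems.GoldfeldAllTwistsTwoConverseTwinQuarterTraceIndexB4SevenModEightOrBetaModFourUnion
import Summits.BirchSwinnertonDyer.BirchSwinnertonDyer.Theorems.GoldfeldAllTwistsTwoConverseTwinQuarterTraceIndexB4AlphaPlusModFourUnionSharp
import Summits.BirchSwinnertonDyer.BirchSwinnertonDyer.Theorems.GoldfeldAllTwistsTwoConverseTwinQuarterTraceIndexB4BetaPlusSharp
import HarnessLib

set_option linter.dupNamespace false -- namespace `…BirchSwinnertonDyer.BirchSwinnertonDyer…` is the cell's (D-0017 nested layout)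
set_option autoImplicit false

/-!
# `BSD(W, 2)` ON THE WHOLE FIRST-DESCENT-SHARP LOCUS of the two-prime family `W ≅ 49a1^{(−2qp)}` — the FORMULA-AXIS GRAND CAPSTONE
# (twelve of the sixteen cells as ONE statement, by name; companion of `…QuarterTraceSharpLocusUnion`)

Cell `bsd-goldfeld`, seat `bsd-goldfeld-s1p-c3x` (gen 18). `--supports stmt-BirchSwinnertonDyer-19140` as a HELPER (formula axis). Theses-free; ONE
theorem; no definition, no new fact, no `sorry`, no kit. Precedents: U′-F (`…IndexB4SevenModEightOrBetaModFourUnion` §2, `(p/q) = −1`, «`q ≡ 7 (8)` or β»,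
EIGHTEEN inputs), object 6F (`…IndexB4AlphaPlusModFourUnionSharp`, type α at `(p/q) = +1`, SEVENTEEN), Fβ⁺-6 (`…IndexB4BetaPlusSharp` §3, type β,
`p ≡ 5 (8)`, `(p/q) = +1`, SIXTEEN). Binders = their union BY NAME = U′-F's EIGHTEEN (`hCST hGZ h12 h44 h13 h14 hS31 hnew hM hBT hBF hGZK hEta hEta₀ hD`
+ `hBCST` + `hpar` + `hKo`), nothing else; NO Cassels–Tate.
THE LOCUS (as in the rank-axis companion): `(p/q) = −1` with (`q ≡ 7 (8)` or type β), or `(p/q) = +1` with (type α or `p ≡ 5 (8)`) — every cell on which the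
`2`-isogeny Selmer pair of `W` is `(2, 4)`; the complement C1 ∪ C2 ∪ b31+ ∪ b71+ is the `(4, 8)` locus (memos `HOME/PLUS-CHIZ-CHANNEL.md` §0,
`HOME/NONSHARP-CHIZ-VANISHING.md`), where rank `3` is witnessed on every cell (`(q,p) = (19,337)`, `(19,37)`, `(139,193)`, `(311,193)`: rank `W(ℚ) = 3` by PARI
2-descent (`ellrank = [3,3]`), kit j332292 / j332195 / j332193, planner re-check j332421 — NUMERICS, not kernel), the isogeny descent does not bound the rank by `1`, a rank-one member has
`Ш(W)[2] ≠ 0` by counting, and the Heegner point over `K` halves at least twice (`I₀ ≡ 0 (mod 4)` on 168/168 computed rank-one rows) — so neither the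
first-descent road to `Ш(W)[2] = 0` nor the «halving exactly once» index bit of the B⁗ closers exists there.
HONEST FRAMING: a by-name union of density-ZERO sub-families modulo named print (SELMER-DRIFT ceiling); FRONTIER-grade, never distance-to-summit; twin″
(item 19140) is NOT closed; items 19350 / 20044 unchanged; BSD is not proved by any of this.

References: [Miller2011LMS] Def. 1.1; [GrossZagier1986] Thm I.(6.3), V.§2; [Gross1984] §§4–5; [CoatesLiTianZhai2015] Thm 1.2–1.4, 4.4; [LiMa2008] Thm 0.4;
[BurungaleCastellaSkinnerTian2022] Thm A, Rem. D; [SilvermanAEC2009] X.4.14.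
-/

noncomputable section

open scoped Classical

open WeierstrassCurve NumberField Literature.NumberTheory Literature.NumberTheory.EllipticCurves
  Literature.NumberTheory.EllipticCurves.ModularForms Literature.NumberTheory.EllipticCurves.CaiShuTian2014
  Literature.NumberTheory.EllipticCurves.CoatesLiTianZhai2015

namespace Summit.BirchSwinnertonDyer.BirchSwinnertonDyer.Theorems.GoldfeldGoodTwists

section CapstoneFormulaSharpLocus

variable (hCST : thm11_ringClassChar)
  (hGZ : ∀ (N : ℕ) [NeZero N] (W : WeierstrassCurve ℚ) (K : Type) [Field K] [NumberField K], gross_zagier N W K)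
  (h12 : thm12_fullBSD_twist) (h44 : thm44_ord_two_LAlg) (h13 : thm13_ord_two_LAlg) (h14 : thm14_rankOne_twist)
  (hS31 : bsdTriple_of_rank_le_one_of_conductor_lt) (hnew : exists_isNewformOf) (hM : OptimalCurveManinCertificate cm7)
  (hBT : burungaleTian_analyticRank_eq_zero_of_selmerCorank_eq_zero_of_hasCM) (hBF : bsdTriple_of_hasCM_of_L_one_ne_zero)
  (hGZK : rank_eq_analyticRank_of_analyticRank_le_one) (hEta : x049_heegner_norm_x_sub_two_not_mem)
  (hEta₀ : x049_x_sub_two_eq_etaQuotient) (hD : deuring_etaQuotient49_heegner_generates_conjPrime)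
  (hBCST : BurungaleCastellaSkinnerTian2022.thmA_analyticRank_eq_one_of_selmerCorank_eq_one)
  (hpar : ∀ (V : WeierstrassCurve ℚ) [V.IsElliptic], p_parity V 2)
  (hKo : ∀ (N : ℕ) [NeZero N] (W : WeierstrassCurve ℚ) (K : Type) [Field K] [NumberField K], kolyvagin N W K)
include hCST hGZ h12 h44 h13 h14 hS31 hnew hM hBT hBF hGZK hEta hEta₀ hD hBCST hpar hKo

/-- **`BSD(W, 2)` ON THE WHOLE FIRST-DESCENT-SHARP LOCUS, FROM PRINT + KOLYVAGIN.** `q > 3` prime, `q ≡ 3 (mod 4)`, `(q/7) = −1`; `p ≡ 1 (mod 4)`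
prime, `(−7/p) = +1`; EITHER `(p/q) = −1` with `q ≡ 7 (mod 8)` or type β, OR `(p/q) = +1` with type α or `p ≡ 5 (mod 8)`; `W/ℚ` globally minimal
elliptic with `C • W = X₀(49)^{(−2qp)}`: **`BSD(W, 2)`** (Miller: rank part, `Ш(W)[2^∞]` finite, `ord₂ #Ш_an = ord₂ #Ш[2^∞]`) — by cases onto U′-F
`bsdp_two_negTwoPrimesTwist_sevenModEightOrBeta_modFour_of_print` ∣ object 6F `bsdp_two_negTwoPrimesTwist_alphaPlus_threeModFour_of_print_sharp` ∣
Fβ⁺-6 `bsdp_two_negTwoPrimesTwist_betaPlusPFive_of_print_sharp`. EIGHTEEN named inputs (U′-F's), nothing else; NO Cassels–Tate. With the rank-axis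
companion `analyticRank_eq_one_twoPrimesTwist_sharpLocus_of_print`: `BSD(W,2) ∧ r_an(W) = rank W(ℚ) = 1 ∧ Ш(W)` finite on TWELVE of the sixteen cells;
the four excluded cells are the `(4, 8)` cells, each with rank-`3` members (PARI 2-descent numerics, not kernel). Density-zero sub-families modulo named print; FRONTIER-grade; twin″ NOT closed; BSD is not proved by
any of this. [cite: Miller2011LMS, Def. 1.1] [cite: GrossZagier1986, Thm. I.(6.3) and V.§2] [cite: CoatesLiTianZhai2015, Thm. 1.2 (p. 359), 1.3, 1.4 and 4.4]
[cite: LiMa2008, Thm. 0.4] [cite: BurungaleCastellaSkinnerTian2022, Thm. A (p. 326) and Rem. D (p. 327)] [cite: SilvermanAEC2009, Thm. X.4.14] -/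
theorem bsdp_two_negTwoPrimesTwist_sharpLocus_of_print_sharp
    {q p : ℕ} (hq : q.Prime) (h3 : 3 < q) (hq4 : q % 4 = 3) (hq7 : jacobiSym q 7 = -1)
    [Fact p.Prime] (hp4 : p % 4 = 1) (hp7 : legendreSym p (-7) = 1)
    (hcell : (jacobiSym (p : ℤ) q = -1 ∧ (q % 8 = 7 ∨ ∃ x : ZMod p, x ^ 4 = -7)) ∨
      (jacobiSym (p : ℤ) q = 1 ∧ ((¬ ∃ x : ZMod p, x ^ 4 = -7) ∨ p % 8 = 5)))
    (W : WeierstrassCurve ℚ) [W.IsElliptic] [W.IsGloballyMinimal] (C : VariableChange ℚ)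
    (hC : C • W = cm7.quadraticTwist (-(2 * (q : ℚ) * p))) : BSDp W 2 := by
  rcases hcell with ⟨hpq, hc⟩ | ⟨hpq, hc⟩
  · exact bsdp_two_negTwoPrimesTwist_sevenModEightOrBeta_modFour_of_print hCST hGZ h12 h44 h13 h14 hS31 hnew hM hBT hBF hGZK hEta hEta₀ hD hBCST hpar
      hKo hq h3 hq4 hq7 hp4 hp7 hpq hc W ⟨C, hC⟩
  · by_cases hβ : ∃ x : ZMod p, x ^ 4 = -7
    · have hp8 : p % 8 = 5 := hc.resolve_left (not_not.mpr hβ)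
      exact bsdp_two_negTwoPrimesTwist_betaPlusPFive_of_print_sharp hCST hGZ h12 h44 h13 h14 hS31 hnew hM hBT hBF hGZK hEta hEta₀ hD hKo hq h3 hq4 hq7
        hp8 hp7 hβ hpq W C hC
    · exact bsdp_two_negTwoPrimesTwist_alphaPlus_threeModFour_of_print_sharp hCST hGZ h12 h44 h14 hS31 hnew hM hBT hBF hGZK hEta hEta₀ hD hBCST hpar
        hKo hq h3 hq4 hq7 hp4 hp7 hβ hpq W C hC

end CapstoneFormulaSharpLocus

end Summit.BirchSwinnertonDyer.BirchSwinnertonDyer.Theorems.GoldfeldGoodTwists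

end
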